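import Literature.AnabelianGeometry.SemiGraphs.StableReductionTowerNonVacuity
import HarnessLib

/-!
# [SemiAnbd] Example 5.6 over the ORIGIN certificate (FACT-LIST rows F-1449, F-1450, F-1451):
# schema verdicts — the universal closures over `Ω : StableReductionOrigin 𝓥 K` are false

Mochizuki, *Semi-graphs of anabelioids*, Publ. RIMS **42** (2006) [SemiAnbd], Example 5.6 pp. 67–68 of
the author's manuscript (kurims `paper:url-f33ace170ff4`). [cite: MochizukiSemiAnbd2006, Ex 5.6, pp. 67–68]

PROOF-ONLY companion of `ArithmeticCurves.lean` (abc-iut-L3-t3, p405547 / p407122; imported, never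
edited) — abc-iut cell, block F fact-proving wave, seat abc-iut-f-158 (tranche 158).  No definition, no
instance, no new named fact; every model is built INSIDE a proof and exported as an `∃`.

`ArithmeticCurves.lean` asserts the printed content of Example 5.6 only for data CERTIFIED by a
§5-local origin `Ω : StableReductionOrigin 𝓥 K` — "`D` IS `π₁^temp(X^log_K)` of a smooth log curve"
(`Ω.IsOfGeometricOrigin D`) and "`T` IS the stable-reduction tower of Example 5.6 for that curve"
(`Ω.IsStableReductionTowerOf D T`) — as the named facts

* F-1451 `Ex56PropertiesStatement Ω` ("`𝔊_i`, `𝔊^c_i` are [connected,] finite, totally elevated, totally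
  universally sub-coverticial … totally arithmetically estranged"),
* F-1450 `Ex56ObjectRecipeStatement Ω` (the CLAIM: the object map of `𝔊_i → 𝔊_j` is recovered from
  `Π^temp_{𝔊_i} → Π^temp_{𝔊_j}` by the verticial / edge-like subgroup recipe),
* F-1449 `Ex56CompactRigidityStatement Ω` (the `𝔊^c`-claim in rigidity form: an isomorphism of the
  group data carrying `(M_i)` to `(M'_i)` comes with compatible isomorphisms `𝔊^c_i ⥲ 𝔊'^c_i`).

The certificates are uninterpreted fields (FOUNDATIONS rows 13–14: André's `π₁^temp` and stable
reduction are not constructed in the tree), so the universal closure of each row ranges over junk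
origins.  This file records the rows' KERNEL STATUS AS TYPED:

1. SCHEMA VERDICTS — `exists_not_ex56Statements` and the literal closures `not_forall_ex56…Statement`:
   at the ALL-CERTIFYING origin over `K = ℚ̄` (`G_K = 1`) all three
   typed statements FAIL, on the junk towers the file's own ORIGIN GUARD names ("would … be refuted by
   junk towers over a genuine `D` (e.g. all decomposition groups `:= ⊤`)"): `Π = G_{ℚ̄} = 1`
   (abc-iut-L3-t7's `TemperedArithmeticGroup.exists_subsingleton_of_isAlgClosed`,
   `StableReductionTowerNonVacuity.lean`), `M_i = Π`, every level the one-vertex / one-edge arithmetic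
   semi-graph of `exists_oneVertexOneEdge_arithSemiGraph` (interface on the one-object category
   `Discrete PUnit`, all adjective predicates `True`, `π̂₁(A) = 1` acting trivially — this is ALSO the
   `ArithSemiGraph` producer that file names as its "single remaining input", whence the outright
   inhabitation `StableReductionTower.exists_inhabited`), ALL decomposition groups `⊤`, CONSTANT
   specialisation maps.  (F-1451) the edge is not arithmetically
   estranged: `Π_b ∩ Π_{b'} = ⊤` is arithmetically ample, every subgroup of `G_K = 1` being open;
   (F-1450) the edge clause of the recipe forces `spV v₀ = inr e₀` while `spV v₀ := inl v₀`; (F-1449) the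
   towers with `spVc := inl v₀`, `spVc := inr e₀` over the SAME `D` (`α = id`, `M_i ↦ M_i`) admit no
   compatible isomorphisms, as `Sum.map _ _ (inl v₀) ≠ inr e₀`.
2. VACUITY IN THE OTHER DIRECTION — `ex56…Statement_of_forall_not`: at an origin certifying NO tower the
   three statements hold trivially.  Each typed predicate carries content only through its certificate:
   an admissible ASSUMPTION BY NAME at certified data (L3 sub-DAG Thm 5.4 row T54-9 "NOT DISCHARGEABLE
   for variable Ω"), neither provable nor refutable there inside the tree.
3. NOT TOUCHED: the group-theoretic conjunct (1) of F-1450 ("these characterizations make sense", from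
   Rmk 5.3.1 + Thm 5.4 (i) at the levels) is `ArithmeticCurvesEx56RecipeWellDefined.lean` (p432032).

HONEST FRAMING: a refuted universal closure over ABSTRACT certificates says only that the origin
certificate of OUR typing is load-bearing; nothing of [SemiAnbd] Example 5.6 is contradicted or
asserted; the junk models are labelled as such; no side is taken on [IUTchIII] Cor. 3.12; typed ≠ proved.
-/

noncomputable section

namespace Literature.AnabelianGeometry.SemiGraphs

open _root_.CategoryTheory Literature.AlgebraicGeometry.Frobenioids Topology

universe u v w u'

/-! ### §2 A one-vertex, one-edge arithmetic semi-graph of anabelioids (junk interface, junk object) -/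

/-- **An inhabitant of `ArithSemiGraph 𝓥` for SOME interface `𝓥`** (Def 5.1 (ii) as typed in
`Arithmetic.lean`): on the one-object category `Discrete PUnit` take the interface whose every object has
ONE vertex and ONE edge with two branches both abutting to the vertex, all localizations the object
itself, all structure maps identities, `Out(π̂₁(𝒢_v)) := 1`, and EVERY adjective predicate (`IsCoherent`,
`IsTotallyElevated`, `IsTotallyUnivSubcoverticial`, …, `IsTempered` arrows) declared `True`; the object is
then connected (vertex and edge are incident), and with arithmetic component `π̂₁(A) := 1` (topologically
finitely generated by `∅`, slim) acting trivially, conditions (a)–(d) of Def 5.1 (i) hold for `H = π̂₁(A)`.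
Exported: `π̂₁(A)` has one element, the object is finite, it has a vertex, and an edge with two distinct
branches.  JUNK (no anabelioid anywhere); it exists only to populate the levels of the junk towers below.
[cite: MochizukiSemiAnbd2006, Def 5.1 (ii), p. 62] -/
theorem exists_oneVertexOneEdge_arithSemiGraph :
    ∃ (𝓥 : SemiAnbdVocab.{0, 0, 0} (Discrete PUnit.{1})) (𝔊 : ArithSemiGraph 𝓥),
      Subsingleton 𝔊.PA ∧ 𝓥.IsFinite 𝔊.G ∧ Nonempty (𝓥.Vert 𝔊.G) ∧
        ∃ (e : 𝓥.Edge 𝔊.G) (b b' : 𝓥.Br e), b ≠ b' := by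
  let 𝓥 : SemiAnbdVocab.{0, 0, 0} (Discrete PUnit.{1}) :=
    { Vert := fun _ => Unit
      Edge := fun _ => Unit
      Br := fun _ => Bool
      abut := fun _ => some ()
      natCard_br := fun _ => by simp
      mapV := fun _ v => v
      mapE := fun _ e => e
      mapBr := fun _ _ b => b
      mapBr_bijective := fun _ _ => Function.bijective_id
      abut_mapBr := fun _ _ _ _ _ => rfl
      mapV_id := fun _ _ => rfl
      mapV_comp := fun _ _ _ => rfl
      mapE_id := fun _ _ => rfl
      mapE_comp := fun _ _ _ => rfl
      locV := fun G _ => G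
      locE := fun G _ => G
      locB := fun G _ _ => G
      ιV := fun G _ => 𝟙 G
      ιE := fun G _ => 𝟙 G
      ιB := fun G _ _ => 𝟙 G
      βV := fun G _ _ _ _ => 𝟙 G
      βE := fun G _ _ => 𝟙 G
      βV_ι := fun _ _ _ _ _ => Subsingleton.elim _ _
      βE_ι := fun _ _ _ => Subsingleton.elim _ _
      centerV := fun _ _ => ()
      mapV_centerV := fun _ _ => rfl
      centerE := fun _ _ => ()
      mapE_centerE := fun _ _ => rfl
      locMapV := fun f _ _ _ => f
      locMapE := fun f _ _ _ => f
      locMapV_ι := fun _ _ _ _ => Subsingleton.elim _ _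
      locMapE_ι := fun _ _ _ _ => Subsingleton.elim _ _
      locMapV_id := fun _ _ _ => Subsingleton.elim _ _
      locMapV_comp := fun _ _ _ _ _ _ _ _ => Subsingleton.elim _ _
      locMapE_id := fun _ _ _ => Subsingleton.elim _ _
      locMapE_comp := fun _ _ _ _ _ _ _ _ => Subsingleton.elim _ _
      vertDegree := fun _ _ => 1
      OutVert := fun _ _ => ProfiniteGrp.of PUnit.{1}
      outRep := fun _ _ _ => 1
      IsOfInjectiveType := fun _ => True
      IsQuasiCoherent := fun _ => True
      IsCoherent := fun _ => True
      isQuasiCoherent_of_isCoherent := fun _ _ => trivial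
      IsTotallyElevated := fun _ => True
      IsTotallyUnivSubcoverticial := fun _ => True
      IsTotallyEstranged := fun _ => True
      IsLocallyTrivial := fun _ => True
      IsLocallyFiniteEtale := fun _ => True
      IsFiniteEtale := fun _ => True
      IsTempered := fun _ => True
      isLocallyFiniteEtale_of_isLocallyTrivial := fun _ _ => trivial
      isLocallyFiniteEtale_of_isFiniteEtale := fun _ _ => trivial
      isTempered_of_isFiniteEtale := fun _ _ => trivial
      isLocallyFiniteEtale_of_isTempered := fun _ _ => trivial
      isLocallyTrivial_id := fun _ => trivial
      isLocallyFiniteEtale_comp := fun _ _ _ _ => trivial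
      isLocallyTrivial_ιV := fun _ _ => trivial
      isLocallyTrivial_ιE := fun _ _ => trivial
      isLocallyTrivial_βV := fun _ _ _ _ _ => trivial
      isLocallyTrivial_βE := fun _ _ _ => trivial
      isLocallyFiniteEtale_locMapV := fun _ _ _ _ _ => trivial
      isLocallyFiniteEtale_locMapE := fun _ _ _ _ _ => trivial }
  let G : Discrete PUnit.{1} := ⟨⟨⟩⟩
  -- the underlying semi-graph (one vertex, one edge, both branches abutting) is connected
  have hconn : 𝓥.IsConnected G := by
    refine ⟨⟨Sum.inl ()⟩, fun x y => ?_⟩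
    have h01 : Relation.EqvGen (𝓥.Incident G) (Sum.inl ()) (Sum.inr ()) :=
      Relation.EqvGen.rel _ _ ⟨true, rfl⟩
    rcases x with ⟨⟨⟩⟩ | ⟨⟨⟩⟩ <;> rcases y with ⟨⟨⟩⟩ | ⟨⟨⟩⟩
    exacts [Relation.EqvGen.refl _, h01, h01.symm _ _, Relation.EqvGen.refl _]
  let PA : ProfiniteGrp.{0} := ProfiniteGrp.of PUnit.{1}
  haveI hPA : Subsingleton PA := inferInstanceAs (Subsingleton PUnit)
  let ρ : PA →* Aut G := 1
  have hcont : IsContinuousAction 𝓥 G PA ρ := by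
    refine ⟨⊤, ?_⟩
    have hfix : ∀ h ∈ (⊤ : OpenSubgroup PA), ∀ v : 𝓥.Vert G, 𝓥.mapV (ρ h).hom v = v :=
      fun _ _ _ => rfl
    exact
      { condA := ⟨⟨∅, Subsingleton.elim _ _⟩⟩
        condB := fun _ => inferInstanceAs (Finite {x : (Σ _e : Unit, Bool) // _})
        condC :=
          { fixesVert := hfix
            fixesBr := fun _ _ _ => rfl
            continuous_outRep := fun _ => continuous_const }
        condD := ⟨Set.univ, Set.finite_univ, fun w => ⟨w, Set.mem_univ _, Iso.refl _,
          fun _ _ => Subsingleton.elim _ _⟩⟩ }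
  let 𝔊 : ArithSemiGraph 𝓥 :=
    { G := G
      connected := hconn
      coherent := trivial
      PA := PA
      slim := ⟨fun _ _ => Subsingleton.elim _ _⟩
      ρ := ρ
      continuous := hcont }
  exact ⟨𝓥, 𝔊, hPA, ⟨inferInstanceAs (Finite Unit), inferInstanceAs (Finite Unit)⟩, ⟨()⟩,
    (), true, false, fun h => Bool.noConfusion h⟩

/-- **`StableReductionTower` is inhabited outright** (closing the "single remaining input" of
abc-iut-L3-t7's `StableReductionTower.exists_of_arithSemiGraph`): over the interface and the one-vertex /
one-edge arithmetic semi-graph of `exists_oneVertexOneEdge_arithSemiGraph` and the degenerate `D` over any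
algebraically closed field, some Example 5.6 tower record exists.  DEGENERATE and labelled so (constant
tower over `Π = 1`); nothing here is the stable-reduction tower of a curve.
[cite: MochizukiSemiAnbd2006, Ex 5.6, p. 67] -/
theorem StableReductionTower.exists_inhabited (K : Type) [Field K] [IsAlgClosed K] :
    ∃ (𝓥 : SemiAnbdVocab.{0, 0, 0} (Discrete PUnit.{1})) (D : TemperedArithmeticGroup K),
      Nonempty (StableReductionTower 𝓥 D) := by
  obtain ⟨𝓥, 𝔊, hPA, -⟩ := exists_oneVertexOneEdge_arithSemiGraph
  haveI := hPA
  obtain ⟨D, hD⟩ := StableReductionTower.exists_of_arithSemiGraph K 𝔊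
  exact ⟨𝓥, D, hD⟩

/-! ### §3 The all-certifying origin over junk towers: the three universal closures fail -/

/-- Conjugates of the whole group are the whole group. [folklore] -/
private theorem conjSubgroup_top {G : Type*} [Group G] (g : G) :
    conjSubgroup g (⊤ : Subgroup G) = ⊤ :=
  Subgroup.map_top_of_surjective _ (MulAut.conj g).surjective

/-- **FACT-LIST F-1451 / F-1450 / F-1449, `∃`-form: at the all-certifying origin over `ℚ̄` the typed
`Ex56PropertiesStatement`, `Ex56ObjectRecipeStatement`, `Ex56CompactRigidityStatement` all FAIL.**
Origin: `IsOfGeometricOrigin := ⊤`, `IsStableReductionTowerOf := ⊤`.  Data: `Π = G_{ℚ̄} = 1`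
(`exists_subsingleton_of_isAlgClosed`); towers `T s` with `M_i = Π`, `admKer_i = 1`, every level the
one-vertex / one-edge arithmetic semi-graph of `exists_oneVertexOneEdge_arithSemiGraph`, arithmetic
components embedded by the trivial map (an isomorphism onto `M_i/N_i = 1`), ALL decomposition groups `⊤`
(the junk the ORIGIN GUARD of `ArithmeticCurves.lean` names), every specialisation map the constant `s`.
(F-1451) total arithmetic estrangement (Def 5.3 (ii)) fails at the edge: `Π_b ∩ Π_{b'} = ⊤` is
arithmetically ample, every subgroup of `G_K = 1` being open; (F-1450) for `j = i = 0` the edge clause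
of the recipe yields `spV v₀ = inr e₀`, but `spV v₀ = inl v₀`; (F-1449) for the towers `T (inl v₀)`,
`T (inr e₀)` over the same `D` and `α = id` (which carries `M_i = Π` to `M_i`), compatibility of any
family `φ` at `i = j = 0`, `v₀` reads `inr e₀ = Sum.map _ _ (inl v₀)`, absurd.  Refutes the closures of
OUR certificate-guarded typings, not [SemiAnbd] Example 5.6. [cite: MochizukiSemiAnbd2006, Ex 5.6, pp. 67–68] -/
theorem exists_not_ex56Statements :
    ∃ (𝓥 : SemiAnbdVocab.{0, 0, 0} (Discrete PUnit.{1}))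
      (Ω : StableReductionOrigin 𝓥 (AlgebraicClosure ℚ)),
      (∀ D, Ω.IsOfGeometricOrigin D) ∧ (∀ D T, Ω.IsStableReductionTowerOf D T) ∧
        ¬ Ex56PropertiesStatement Ω ∧ ¬ Ex56ObjectRecipeStatement Ω ∧
          ¬ Ex56CompactRigidityStatement Ω := by
  classical
  obtain ⟨𝓥, 𝔊, hPA, -, ⟨v₀⟩, e₀, b₀, b₁, hb⟩ := exists_oneVertexOneEdge_arithSemiGraph
  obtain ⟨D, hD⟩ :=
    TemperedArithmeticGroup.exists_subsingleton_of_isAlgClosed (AlgebraicClosure ℚ)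
  haveI := hD
  haveI hGK : Subsingleton (Field.absoluteGaloisGroup (AlgebraicClosure ℚ)) :=
    D.aug_surjective.subsingleton
  haveI := hPA
  -- the all-certifying origin: every `D` is "of geometric origin", every tower "is the tower of Ex 5.6"
  let Ω : StableReductionOrigin 𝓥 (AlgebraicClosure ℚ) :=
    { IsOfGeometricOrigin := fun _ => True
      IsTateOrigin := fun _ => True
      isOfGeometricOrigin_of_isTateOrigin := fun _ _ => trivial
      IsStableReductionTowerOf := fun _ _ => True
      isOfGeometricOrigin_of_isStableReductionTowerOf := fun _ _ _ => trivial }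
  -- junk towers over `D`: `M_i = Π (= 1)`, `𝔊_i = 𝔊^c_i = 𝔊`, `admKer_i = 1`, ALL decomposition groups
  -- `⊤` (one edge carrying every branch, all abutting to `v₀`), constant specialisation maps `s`
  let T : (𝓥.Vert 𝔊.G ⊕ 𝓥.Edge 𝔊.G) → StableReductionTower 𝓥 D := fun s =>
    { M := fun _ => ⊤
      isOpen_M := fun _ => Subsingleton.set_cases (p := fun t : Set D.Pi => IsOpen t)
        isOpen_empty isOpen_univ _
      finiteIndex_M := fun _ => inferInstance
      characteristic_M := fun _ _ => Subsingleton.elim _ _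
      antitone_M := fun _ _ _ => le_rfl
      exhaustive_M := Subsingleton.elim _ _
      𝔊 := fun _ => 𝔊
      𝔊c := fun _ => 𝔊
      arithEmb := fun _ => 1
      continuous_arithEmb := fun _ => continuous_const
      injective_arithEmb := fun _ => Function.injective_of_subsingleton _
      range_arithEmb := fun _ => Subsingleton.elim _ _
      arithEmbc := fun _ => 1
      continuous_arithEmbc := fun _ => continuous_const
      injective_arithEmbc := fun _ => Function.injective_of_subsingleton _
      range_arithEmbc := fun _ => Subsingleton.elim _ _
      admKer := fun _ => ⊥
      admKer_le := fun _ => bot_le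
      admKer_normal := fun _ => by rw [Subgroup.bot_subgroupOf]; infer_instance
      admKer_mono := fun _ _ _ => le_rfl
      dec := fun _ =>
        { E := Unit, edgeOf := fun _ => (), abut := fun _ => some v₀,
          vertGp := fun _ => ⊤, brGp := fun _ => ⊤, brGp_le_vertGp := fun _ _ _ => le_top }
      decc := fun _ =>
        { E := Unit, edgeOf := fun _ => (), abut := fun _ => some v₀,
          vertGp := fun _ => ⊤, brGp := fun _ => ⊤, brGp_le_vertGp := fun _ _ _ => le_top }
      spV := fun _ _ _ _ => s
      spE := fun _ _ _ _ => s
      spVc := fun _ _ _ _ => s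
      spEc := fun _ _ _ _ => s }
  -- over a one-element `G_K` every subgroup is arithmetically ample (its image is open)
  have hample : ∀ (P : Type) [Group P] (f : P →* Field.absoluteGaloisGroup (AlgebraicClosure ℚ))
      (S : Subgroup P), IsArithAmple f S := fun P _ f S =>
    Subsingleton.set_cases (p := fun t : Set (Field.absoluteGaloisGroup (AlgebraicClosure ℚ)) =>
      IsOpen t) isOpen_empty isOpen_univ _
  have hne : (⟨e₀, b₁⟩ : Σ e : 𝓥.Edge 𝔊.G, 𝓥.Br e) ≠ ⟨e₀, b₀⟩ := fun heq =>
    hb.symm (eq_of_heq (Sigma.mk.inj_iff.mp heq).2)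
  -- (1) Ex 5.6 "properties": total arithmetic estrangement fails for the all-`⊤` decomposition data
  have h1 : ¬ Ex56PropertiesStatement Ω := by
    intro h
    have hest := (h D trivial (T (Sum.inl v₀)) trivial 0).1.2.2.2
    exact ((hest () ⟨e₀, b₀⟩ rfl v₀ rfl 1 (Subgroup.one_mem _)).1 ⟨e₀, b₁⟩ rfl hne)
      (hample _ _ _)
  -- (2) Ex 5.6 "recipe": the edge clause forces `spV v₀ = inr e₀`, but `spV v₀ := inl v₀`
  have h2 : ¬ Ex56ObjectRecipeStatement Ω := by
    intro h
    have hv := ((h D trivial (T (Sum.inl v₀)) trivial 0 0 le_rfl).1 v₀).2.1 ⟨e₀, b₀⟩ 1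
      (by rw [conjSubgroup_top]; exact le_top)
    exact Sum.inl_ne_inr hv
  -- (3) Ex 5.6 "compact rigidity": the towers with `spVc := inl v₀` and `spVc := inr e₀` over the SAME
  -- `D` (identity isomorphism) admit no compatible family of isomorphisms
  have h3 : ¬ Ex56CompactRigidityStatement Ω := by
    intro h
    obtain ⟨φ, -, hcompat⟩ := h D D trivial trivial (T (Sum.inl v₀)) (T (Sum.inr e₀)) trivial trivial
      (ContinuousMulEquiv.refl _) (fun _ => rfl) (fun _ => Subsingleton.elim _ _)
    have hv := (hcompat 0 0 le_rfl).1 v₀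
    exact Sum.inr_ne_inl hv
  exact ⟨𝓥, Ω, fun _ => trivial, fun _ _ => trivial, h1, h2, h3⟩

/-! ### §4 The literal universal closures are false -/

/-- **FACT-LIST F-1451 — the universal closure of `Ex56PropertiesStatement` is FALSE** (schema row:
the predicate is an assumption BY NAME at certified data, vacuous at non-certifying origins
(`ex56PropertiesStatement_of_forall_not`), false at the all-certifying junk origin of
`exists_not_ex56Statements`). [cite: MochizukiSemiAnbd2006, Ex 5.6, p. 67] -/
theorem not_forall_ex56PropertiesStatement :
    ¬ ∀ (Obj : Type) [Category.{0} Obj] (𝓥 : SemiAnbdVocab.{0, 0, 0} Obj) (K : Type) [Field K]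
        (Ω : StableReductionOrigin 𝓥 K), Ex56PropertiesStatement Ω := by
  intro h
  obtain ⟨𝓥, Ω, -, -, h1, -, -⟩ := exists_not_ex56Statements
  exact h1 (h _ 𝓥 _ Ω)

/-- **FACT-LIST F-1450 — the universal closure of `Ex56ObjectRecipeStatement` is FALSE** (schema row;
its group-theoretic conjunct (1) is proved for every tower from F-1410 + F-1398 in
`ArithmeticCurvesEx56RecipeWellDefined.lean`; conjuncts (2)/(3) are the certified geometric content).
[cite: MochizukiSemiAnbd2006, Ex 5.6, pp. 67–68] -/
theorem not_forall_ex56ObjectRecipeStatement :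
    ¬ ∀ (Obj : Type) [Category.{0} Obj] (𝓥 : SemiAnbdVocab.{0, 0, 0} Obj) (K : Type) [Field K]
        (Ω : StableReductionOrigin 𝓥 K), Ex56ObjectRecipeStatement Ω := by
  intro h
  obtain ⟨𝓥, Ω, -, -, -, h2, -⟩ := exists_not_ex56Statements
  exact h2 (h _ 𝓥 _ Ω)

/-- **FACT-LIST F-1449 — the universal closure of `Ex56CompactRigidityStatement` is FALSE** (schema
row: rigidity of `𝔊^c_i` under isomorphisms of the group data holds only for CERTIFIED towers, whose
`𝔊^c_i`, `spVc`, `spEc` ARE the special-fibre data; on free tower data it fails already for `α = id`).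
[cite: MochizukiSemiAnbd2006, Ex 5.6, p. 68] -/
theorem not_forall_ex56CompactRigidityStatement :
    ¬ ∀ (Obj : Type) [Category.{0} Obj] (𝓥 : SemiAnbdVocab.{0, 0, 0} Obj) (K : Type) [Field K]
        (Ω : StableReductionOrigin 𝓥 K), Ex56CompactRigidityStatement Ω := by
  intro h
  obtain ⟨𝓥, Ω, -, -, -, -, h3⟩ := exists_not_ex56Statements
  exact h3 (h _ 𝓥 _ Ω)

/-! ### §5 Vacuity in the other direction: origins certifying no tower -/

section Vacuity

variable {Obj : Type u} [Category.{v} Obj] {𝓥 : SemiAnbdVocab.{u, v, w} Obj}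
variable {K : Type u'} [Field K] (Ω : StableReductionOrigin 𝓥 K)

/-- At an origin certifying NO tower, `Ex56PropertiesStatement` holds vacuously — the typed predicate
carries content only through its certificate. [cite: MochizukiSemiAnbd2006, Ex 5.6, p. 67] -/
theorem ex56PropertiesStatement_of_forall_not
    (h : ∀ (D : TemperedArithmeticGroup K) (T : StableReductionTower 𝓥 D),
      ¬ Ω.IsStableReductionTowerOf D T) :
    Ex56PropertiesStatement Ω :=
  fun D _ T hT => (h D T hT).elim

/-- At an origin certifying NO tower, `Ex56ObjectRecipeStatement` holds vacuously.
[cite: MochizukiSemiAnbd2006, Ex 5.6, pp. 67–68] -/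
theorem ex56ObjectRecipeStatement_of_forall_not
    (h : ∀ (D : TemperedArithmeticGroup K) (T : StableReductionTower 𝓥 D),
      ¬ Ω.IsStableReductionTowerOf D T) :
    Ex56ObjectRecipeStatement Ω :=
  fun D _ T hT => (h D T hT).elim

/-- At an origin certifying NO tower, `Ex56CompactRigidityStatement` holds vacuously.
[cite: MochizukiSemiAnbd2006, Ex 5.6, p. 68] -/
theorem ex56CompactRigidityStatement_of_forall_not
    (h : ∀ (D : TemperedArithmeticGroup K) (T : StableReductionTower 𝓥 D),
      ¬ Ω.IsStableReductionTowerOf D T) :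
    Ex56CompactRigidityStatement Ω :=
  fun D _ _ _ T _ hT _ => (h D T hT).elim

end Vacuity

end Literature.AnabelianGeometry.SemiGraphs

end
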